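import Summits.Ventures.PercRepro.C026PFunLeaf

/-!
# The cycle skeleton through the probe (p6, gen 16; mine-3 §30, SEMANTICS-SPEC A1)

The cycle `C_k` through the probe: vertices `none` (the probe `c`) and `some i` (`v_{i+1}`, `i : Fin k`),
edges `e : Fin (k + 1)` with `e₀ = c v₁`, `e_i = v_i v_{i+1}` (`1 ≤ i ≤ k − 1`), `e_k = v_k c`
(`cycle k : MultiGraph (Option (Fin k)) (Fin (k + 1))`).  In a configuration `ω` the probe's cluster is
the union of the RIGHT ARC (the vertices `v₁ … v_r` reached along `e₀, e₁, …`) and the LEFT ARC (the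
vertices `v_k … v_{k−l+1}` reached along `e_k, e_{k−1}, …`): `cycle_conn_none_iff` — `c ↔ v_{i+1}` iff
all of `e₀ … e_i` are open or all of `e_{i+1} … e_k` are open.  This is the arc description of mine-3's
A1 for the probe's component; the pieces (the remaining clusters, maximal runs of open path edges) are
the subject of the next file.
-/

namespace PercRepro

namespace MultiGraph

open Finset

/-- The cycle skeleton through the probe `none` on the vertices `Option (Fin k)`. -/
def cycle (k : ℕ) : MultiGraph (Option (Fin k)) (Fin (k + 1)) where
  fst e := if h : e.val = 0 then none else some ⟨e.val - 1, by omega⟩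
  snd e := if h : e.val = k then none else some ⟨e.val, by omega⟩

variable {k : ℕ}

/-- `RightArc ω i`: the edges `e₀ … e_i` are all open. -/
def RightArc (ω : Config (Fin (k + 1))) (i : Fin k) : Prop :=
  ∀ m : Fin (k + 1), m.val ≤ i.val → ω m = true

/-- `LeftArc ω i`: the edges `e_{i+1} … e_k` are all open. -/
def LeftArc (ω : Config (Fin (k + 1))) (i : Fin k) : Prop :=
  ∀ m : Fin (k + 1), i.val + 1 ≤ m.val → ω m = true

/-- The endpoints of the edge `e` of the cycle, as a pair of options. -/
theorem cycle_fst (e : Fin (k + 1)) :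
    (cycle k).fst e = if h : e.val = 0 then none else some ⟨e.val - 1, by omega⟩ := rfl

/-- The second endpoint of the edge `e` of the cycle. -/
theorem cycle_snd (e : Fin (k + 1)) :
    (cycle k).snd e = if h : e.val = k then none else some ⟨e.val, by omega⟩ := rfl

/-- A vertex on the right arc is connected to the probe. -/
theorem cycle_conn_of_rightArc {ω : Config (Fin (k + 1))} {i : Fin k} (h : RightArc ω i) :
    (cycle k).Conn ω none (some i) := by
  -- induction on `i.val`: `none → some 0 → some 1 → …`
  obtain ⟨i, hi⟩ := i
  induction i with
  | zero =>
    refine Conn.of_openAdj ⟨⟨0, by omega⟩, h ⟨0, by omega⟩ (le_refl _), Or.inl ⟨?_, ?_⟩⟩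
    · simp [cycle_fst]
    · simp [cycle_snd]
      omega
  | succ n ih =>
    have hn : RightArc ω ⟨n, by omega⟩ := fun m hm => h m (by simp at hm ⊢; omega)
    refine (ih (by omega) hn).trans (Conn.of_openAdj ⟨⟨n + 1, by omega⟩, h ⟨n + 1, by omega⟩ (le_refl _),
      Or.inl ⟨?_, ?_⟩⟩)
    · simp [cycle_fst]
    · simp [cycle_snd]
      omega

/-- The endpoints of `e_k` (`k ≥ 1`): `v_k` and `c`. -/
theorem cycle_fst_last (hk : 0 < k) : (cycle k).fst ⟨k, by omega⟩ = some ⟨k - 1, by omega⟩ := by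
  rw [cycle_fst, dif_neg (by show ¬ (k = 0); omega)]

/-- The second endpoint of `e_k` is the probe. -/
theorem cycle_snd_last : (cycle k).snd ⟨k, by omega⟩ = none := by
  rw [cycle_snd, dif_pos rfl]

/-- The endpoints of an inner edge `e_m` (`1 ≤ m ≤ k − 1`): `v_m` and `v_{m+1}`. -/
theorem cycle_fst_inner {m : ℕ} (h0 : 0 < m) (hk : m < k) :
    (cycle k).fst ⟨m, by omega⟩ = some ⟨m - 1, by omega⟩ := by
  rw [cycle_fst, dif_neg (by show ¬ (m = 0); omega)]

/-- The second endpoint of the inner edge `e_m` is `v_{m+1}`. -/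
theorem cycle_snd_inner {m : ℕ} (hk : m < k) :
    (cycle k).snd ⟨m, by omega⟩ = some ⟨m, by omega⟩ := by
  rw [cycle_snd, dif_neg (by show ¬ (m = k); omega)]

/-- The left arc: from `v_{i+1}` one step towards the probe. -/
theorem cycle_conn_of_leftArc_aux {ω : Config (Fin (k + 1))} (d : ℕ) (hd : d < k)
    (h : LeftArc ω ⟨k - 1 - d, by omega⟩) : (cycle k).Conn ω none (some ⟨k - 1 - d, by omega⟩) := by
  induction d with
  | zero =>
    have hk : 0 < k := by omega
    have he : ω ⟨k, by omega⟩ = true := h ⟨k, by omega⟩ (by simp; omega)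
    refine Conn.of_openAdj ⟨⟨k, by omega⟩, he, Or.inr ⟨?_, cycle_snd_last⟩⟩
    rw [cycle_fst_last hk]
    rfl
  | succ n ih =>
    have hn : LeftArc ω ⟨k - 1 - n, by omega⟩ := fun m hm => h m (by
      simp only at hm ⊢
      omega)
    have hstep := ih (by omega) hn
    -- the edge `e_{k-1-n}` joins `v_{k-1-n}` (= some (k-2-n)) and `v_{k-n}` (= some (k-1-n))
    have he : ω ⟨k - 1 - n, by omega⟩ = true := h ⟨k - 1 - n, by omega⟩ (by simp only; omega)
    refine hstep.trans (Conn.of_openAdj ⟨⟨k - 1 - n, by omega⟩, he, Or.inr ⟨?_, ?_⟩⟩)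
    · rw [cycle_fst_inner (by omega) (by omega)]
      congr 1
    · rw [cycle_snd_inner (by omega)]

/-- A vertex on the left arc is connected to the probe. -/
theorem cycle_conn_of_leftArc {ω : Config (Fin (k + 1))} {i : Fin k} (h : LeftArc ω i) :
    (cycle k).Conn ω none (some i) := by
  obtain ⟨i, hi⟩ := i
  have hd : i = k - 1 - (k - 1 - i) := by omega
  have h' : LeftArc ω ⟨k - 1 - (k - 1 - i), by omega⟩ := by
    convert h using 2
    omega
  have := cycle_conn_of_leftArc_aux (k - 1 - i) (by omega) h'
  convert this using 2
  exact Fin.ext (by omega)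

/-- The edges of the cycle with the probe as first endpoint: only `e₀`. -/
theorem cycle_fst_eq_none_iff (e : Fin (k + 1)) : (cycle k).fst e = none ↔ e.val = 0 := by
  rw [cycle_fst]
  split_ifs with h
  · simp [h]
  · simp [h]

/-- The edges of the cycle with the probe as second endpoint: only `e_k`. -/
theorem cycle_snd_eq_none_iff (e : Fin (k + 1)) : (cycle k).snd e = none ↔ e.val = k := by
  rw [cycle_snd]
  split_ifs with h
  · simp [h]
  · simp [h]

/-- The first endpoint of an edge, when a pendant vertex. -/
theorem cycle_fst_eq_some_iff (e : Fin (k + 1)) (i : Fin k) :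
    (cycle k).fst e = some i ↔ e.val = i.val + 1 := by
  rw [cycle_fst]
  split_ifs with h
  · simp only [false_iff]
    omega
  · simp only [Option.some.injEq, Fin.ext_iff]
    omega

/-- The second endpoint of an edge, when a pendant vertex. -/
theorem cycle_snd_eq_some_iff (e : Fin (k + 1)) (i : Fin k) :
    (cycle k).snd e = some i ↔ e.val = i.val := by
  rw [cycle_snd]
  split_ifs with h
  · simp only [false_iff]
    omega
  · simp only [Option.some.injEq, Fin.ext_iff]

/-- **The probe's cluster in the cycle is the union of the two arcs**: `c ↔ v_{i+1}` iff the edges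
`e₀ … e_i` are all open or the edges `e_{i+1} … e_k` are all open. -/
theorem cycle_conn_none_iff (ω : Config (Fin (k + 1))) (i : Fin k) :
    (cycle k).Conn ω none (some i) ↔ RightArc ω i ∨ LeftArc ω i := by
  constructor
  · intro h
    -- the invariant along any open path from the probe
    have key : ∀ v, (cycle k).Conn ω none v →
        v = none ∨ ∃ j : Fin k, v = some j ∧ (RightArc ω j ∨ LeftArc ω j) := by
      intro v hv
      refine Conn.induction (motive := fun v => v = none ∨ ∃ j : Fin k, v = some j ∧
        (RightArc ω j ∨ LeftArc ω j)) (Or.inl rfl) ?_ hv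
      intro a b _ hab ih
      obtain ⟨e, he, hend⟩ := hab
      rcases ih with rfl | ⟨j, rfl, hj⟩
      · -- from the probe: `e = e₀` (to `v₁`) or `e = e_k` (to `v_k`)
        rcases hend with ⟨hf, hs⟩ | ⟨hf, hs⟩
        · subst hs
          have h0 : e.val = 0 := (cycle_fst_eq_none_iff e).1 hf
          cases hb : (cycle k).snd e with
          | none => exact Or.inl rfl
          | some j =>
            refine Or.inr ⟨j, rfl, Or.inl fun m hm => ?_⟩
            have := (cycle_snd_eq_some_iff e j).1 hb
            have hm0 : m = e := Fin.ext (by omega)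
            rw [hm0]; exact he
        · subst hf
          have hk : e.val = k := (cycle_snd_eq_none_iff e).1 hs
          cases hb : (cycle k).fst e with
          | none => exact Or.inl rfl
          | some j =>
            refine Or.inr ⟨j, rfl, Or.inr fun m hm => ?_⟩
            have := (cycle_fst_eq_some_iff e j).1 hb
            have hm0 : m = e := Fin.ext (by omega)
            rw [hm0]; exact he
      · -- from a pendant vertex on an arc: the neighbour stays on the same arc
        rcases hend with ⟨hf, hs⟩ | ⟨hf, hs⟩
        · -- `fst e = some j`, so `e = e_{j+1}`, `b = snd e`
          subst hs
          have he1 : e.val = j.val + 1 := (cycle_fst_eq_some_iff e j).1 hf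
          cases hb : (cycle k).snd e with
          | none => exact Or.inl rfl
          | some j' =>
            have he2 : e.val = j'.val := (cycle_snd_eq_some_iff e j').1 hb
            refine Or.inr ⟨j', rfl, ?_⟩
            rcases hj with hR | hL
            · exact Or.inl fun m hm => by
                rcases Nat.lt_or_ge m.val e.val with hlt | hge
                · exact hR m (by omega)
                · have : m = e := Fin.ext (by omega)
                  rw [this]; exact he
            · exact Or.inr fun m hm => hL m (by omega)
        · -- `snd e = some j`, so `e = e_j`, `b = fst e`
          subst hf
          have he1 : e.val = j.val := (cycle_snd_eq_some_iff e j).1 hs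
          cases hb : (cycle k).fst e with
          | none => exact Or.inl rfl
          | some j' =>
            have he2 : e.val = j'.val + 1 := (cycle_fst_eq_some_iff e j').1 hb
            refine Or.inr ⟨j', rfl, ?_⟩
            rcases hj with hR | hL
            · exact Or.inl fun m hm => hR m (by omega)
            · exact Or.inr fun m hm => by
                rcases Nat.lt_or_ge e.val m.val with hlt | hge
                · exact hL m (by omega)
                · have : m = e := Fin.ext (by omega)
                  rw [this]; exact he
    rcases key (some i) h with h' | ⟨j, hj, hjarc⟩
    · exact absurd h' (Option.some_ne_none i)
    · rw [Option.some_inj] at hj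
      subst hj
      exact hjarc
  · rintro (h | h)
    · exact cycle_conn_of_rightArc h
    · exact cycle_conn_of_leftArc h


/-! ### The pieces: runs of open path edges -/

/-- `Run ω i j` (`i ≤ j`): the path edges `e_{i+1} … e_j` between `v_{i+1}` and `v_{j+1}` are open. -/
def Run (ω : Config (Fin (k + 1))) (i j : Fin k) : Prop :=
  i.val ≤ j.val ∧ ∀ m : Fin (k + 1), i.val < m.val → m.val ≤ j.val → ω m = true

/-- A run is connected: one open edge at a time. -/
theorem cycle_conn_of_run {ω : Config (Fin (k + 1))} {i j : Fin k} (h : Run ω i j) :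
    (cycle k).Conn ω (some i) (some j) := by
  obtain ⟨i, hi⟩ := i
  obtain ⟨j, hj⟩ := j
  obtain ⟨d, rfl⟩ : ∃ d, j = i + d := ⟨j - i, by have := h.1; simp only at this; omega⟩
  induction d with
  | zero => exact Conn.refl _ ω _
  | succ n ih =>
    have hn : Run ω ⟨i, hi⟩ ⟨i + n, by omega⟩ := ⟨by simp only; omega, fun m h1 h2 => h.2 m h1 (by
      simp only at h2 ⊢; omega)⟩
    have hstep := ih (by omega) hn
    have he : ω ⟨i + n + 1, by omega⟩ = true := h.2 ⟨i + n + 1, by omega⟩ (by simp only; omega) (by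
      simp only; omega)
    refine hstep.trans (Conn.of_openAdj ⟨⟨i + n + 1, by omega⟩, he, Or.inl ⟨?_, ?_⟩⟩)
    · rw [cycle_fst_inner (by omega) (by omega)]
      exact congrArg some (Fin.ext (by show i + n + 1 - 1 = i + n; omega))
    · rw [cycle_snd_inner (by omega)]
      rfl

/-- **The clusters away from the probe are runs**: if `v_{i+1}` is not connected to the probe, then
`v_{i+1} ↔ v_{j+1}` iff the path edges between them are all open. -/
theorem cycle_conn_some_iff {ω : Config (Fin (k + 1))} {i : Fin k}
    (hi : ¬ (cycle k).Conn ω none (some i)) (j : Fin k) :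
    (cycle k).Conn ω (some i) (some j) ↔ Run ω i j ∨ Run ω j i := by
  constructor
  · intro h
    have key : ∀ v, (cycle k).Conn ω (some i) v → ∃ j : Fin k, v = some j ∧ (Run ω i j ∨ Run ω j i) := by
      intro v hv
      refine Conn.induction (motive := fun v => ∃ j : Fin k, v = some j ∧ (Run ω i j ∨ Run ω j i))
        ⟨i, rfl, Or.inl ⟨le_refl _, fun m h1 h2 => absurd h1 (by omega)⟩⟩ ?_ hv
      intro a b hia hab ih
      obtain ⟨j, rfl, hj⟩ := ih
      obtain ⟨e, he, hend⟩ := hab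
      -- `b` is not the probe
      have hb : b ≠ none := by
        rintro rfl
        exact hi ((hia.trans (Conn.of_openAdj ⟨e, he, hend⟩)).symm)
      rcases hend with ⟨hf, hs⟩ | ⟨hf, hs⟩
      · -- `e = e_{j+1}`, `b = snd e = v_{j+2}`: a step to the right
        subst hs
        have he1 : e.val = j.val + 1 := (cycle_fst_eq_some_iff e j).1 hf
        cases hb' : (cycle k).snd e with
        | none => exact absurd hb' hb
        | some j' =>
          have he2 : e.val = j'.val := (cycle_snd_eq_some_iff e j').1 hb'
          refine ⟨j', rfl, ?_⟩
          rcases hj with ⟨hle, hrun⟩ | ⟨hle, hrun⟩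
          · -- `i ≤ j`: extend the run to the right by `e`
            exact Or.inl ⟨by omega, fun m h1 h2 => by
              rcases Nat.lt_or_ge m.val e.val with hlt | hge
              · exact hrun m h1 (by omega)
              · have : m = e := Fin.ext (by omega)
                rw [this]; exact he⟩
          · -- `j ≤ i`: either `j < i` (stay inside the run) or `j = i` (the single edge `e`)
            rcases Nat.lt_or_ge j.val i.val with hlt | hge
            · exact Or.inr ⟨by omega, fun m h1 h2 => hrun m (by omega) h2⟩
            · exact Or.inl ⟨by omega, fun m h1 h2 => by
                have : m = e := Fin.ext (by omega)
                rw [this]; exact he⟩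
      · -- `e = e_j`, `b = fst e = v_j`: a step to the left
        subst hf
        have he1 : e.val = j.val := (cycle_snd_eq_some_iff e j).1 hs
        cases hb' : (cycle k).fst e with
        | none => exact absurd hb' hb
        | some j' =>
          have he2 : e.val = j'.val + 1 := (cycle_fst_eq_some_iff e j').1 hb'
          refine ⟨j', rfl, ?_⟩
          rcases hj with ⟨hle, hrun⟩ | ⟨hle, hrun⟩
          · -- `i ≤ j`: either `i < j` (stay inside) or `i = j` (the single edge `e`)
            rcases Nat.lt_or_ge i.val j.val with hlt | hge
            · exact Or.inl ⟨by omega, fun m h1 h2 => hrun m h1 (by omega)⟩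
            · exact Or.inr ⟨by omega, fun m h1 h2 => by
                have : m = e := Fin.ext (by omega)
                rw [this]; exact he⟩
          · -- `j ≤ i`: extend the run to the left by `e`
            exact Or.inr ⟨by omega, fun m h1 h2 => by
              rcases Nat.lt_or_ge e.val m.val with hlt | hge
              · exact hrun m (by omega) h2
              · have : m = e := Fin.ext (by omega)
                rw [this]; exact he⟩
    obtain ⟨j', hj', hrun⟩ := key (some j) h
    rw [Option.some_inj] at hj'
    subst hj'
    exact hrun
  · rintro (h | h)
    · exact cycle_conn_of_run h
    · exact (cycle_conn_of_run h).symm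


end MultiGraph

end PercRepro
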